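import Summits.Ventures.PercRepro.C041ZoneOCubeDefs

/-!
# The ZONE O-CUBE on one-sided zones (p6, gen 27; C-041.md §14 (a), the boundary of the conjecture)

Setting of `C041ZoneOCubeDefs`.  When the zone carries no `2`-edges (`IsEmpty T₂`) no vertex is `2`-marked: `G1` never
holds, no vertex is deleted on side `2`, `REACH2 = K`, and `G2` is validity itself — so every valid state has weight
`3 − 2 = 1` and the ZONE O-CUBE sum is the number of valid states (`zoneOCube_nonneg_of_isEmpty_T₂`,
`zoneOCubeF_nonneg_of_isEmpty_T₂`).  Symmetrically with no `1`-edges (`zoneOCube_nonneg_of_isEmpty_T₁`,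
`zoneOCubeF_nonneg_of_isEmpty_T₁`).  The conjecture is therefore a statement about zones carrying BOTH kinds of
terminal edges — where mine-3's (b) shows the weighted transport is needed.
-/

namespace PercRepro

namespace ZoneZ

namespace ZoneData

open Finset

variable {V E T₁ T₂ : Type*} (Z : ZoneData V E T₁ T₂) (A : Set V)

/-- With no `2`-edges there are no `2`-marks. -/
theorem Mt_eq_empty [IsEmpty T₂] (σ : State E T₁ T₂) : Z.Mt σ = ∅ := by
  ext v
  constructor
  · rintro ⟨t, _, _⟩
    exact isEmptyElim t
  · intro h
    exact absurd h (Set.notMem_empty v)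

/-- With no `2`-edges there are no blue `2`-marks. -/
theorem M_eq_empty [IsEmpty T₂] (σ : State E T₁ T₂) : Z.M σ = ∅ := by
  ext v
  constructor
  · rintro ⟨t, _, _⟩
    exact isEmptyElim t
  · intro h
    exact absurd h (Set.notMem_empty v)

/-- With no `1`-edges there are no red `1`-marks. -/
theorem Blt_eq_empty [IsEmpty T₁] (σ : State E T₁ T₂) : Z.Blt σ = ∅ := by
  ext v
  constructor
  · rintro ⟨t, _, _⟩
    exact isEmptyElim t
  · intro h
    exact absurd h (Set.notMem_empty v)

/-- With no `1`-edges there are no blockers. -/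
theorem Bl_eq_empty [IsEmpty T₁] (σ : State E T₁ T₂) : Z.Bl σ = ∅ := by
  ext v
  constructor
  · rintro ⟨t, _, _⟩
    exact isEmptyElim t
  · intro h
    exact absurd h (Set.notMem_empty v)

/-- The reach of the empty set is empty. -/
theorem reach_empty (R : V → V → Prop) : reach R (∅ : Set V) = ∅ := by
  ext v
  constructor
  · rintro ⟨s, hs, _⟩
    exact absurd hs (Set.notMem_empty s)
  · intro h
    exact absurd h (Set.notMem_empty v)

/-- The reach inside the whole space is the reach. -/
theorem reachIn_univ (R : V → V → Prop) (S : Set V) : reachIn R Set.univ S = reach R S := by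
  apply Set.Subset.antisymm reachIn_subset_reach
  rw [← Set.inter_univ S]
  exact reach_subset_reachIn_of_closed (Set.subset_univ _) (fun _ _ _ _ => Set.mem_univ _)

/-- With no `2`-edges, `G2` is validity. -/
theorem G2_iff_valid_of_isEmpty_T₂ [IsEmpty T₂] (σ : State E T₁ T₂) : Z.G2 A σ ↔ Z.Valid A σ := by
  unfold G2 Valid blueK REACH2 D2
  rw [Z.M_eq_empty, reach_empty, Set.compl_empty, reachIn_univ, Z.Mt_eq_empty, Set.union_empty]
  constructor
  · rintro ⟨v, hvK, hvB⟩ h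
    exact Set.disjoint_left.1 h hvK hvB
  · intro h
    by_contra h'
    apply h
    rw [Set.disjoint_left]
    intro v hvK hvB
    exact h' ⟨v, hvK, hvB⟩

/-- With no `2`-edges, `G1` never holds. -/
theorem not_G1_of_isEmpty_T₂ [IsEmpty T₂] (σ : State E T₁ T₂) : ¬ Z.G1 A σ := by
  rintro ⟨v, _, hv⟩
  rw [Z.Mt_eq_empty] at hv
  exact absurd hv (Set.notMem_empty v)

/-- With no `1`-edges, `G1` is validity. -/
theorem G1_iff_valid_of_isEmpty_T₁ [IsEmpty T₁] (σ : State E T₁ T₂) : Z.G1 A σ ↔ Z.Valid A σ := by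
  unfold G1 Valid blueK REACH D
  rw [Z.Bl_eq_empty, reach_empty, Set.compl_empty, reachIn_univ, Z.Blt_eq_empty, Set.empty_union]
  constructor
  · rintro ⟨v, hvK, hvM⟩ h
    exact Set.disjoint_left.1 h hvK hvM
  · intro h
    by_contra h'
    apply h
    rw [Set.disjoint_left]
    intro v hvK hvM
    exact h' ⟨v, hvK, hvM⟩

/-- With no `1`-edges, `G2` never holds. -/
theorem not_G2_of_isEmpty_T₁ [IsEmpty T₁] (σ : State E T₁ T₂) : ¬ Z.G2 A σ := by
  rintro ⟨v, _, hv⟩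
  rw [Z.Blt_eq_empty] at hv
  exact absurd hv (Set.notMem_empty v)

open Classical in
/-- With no `2`-edges every state has weight `[valid] ≥ 0`. -/
theorem ocWeight_nonneg_of_isEmpty_T₂ [IsEmpty T₂] (σ : State E T₁ T₂) : 0 ≤ Z.ocWeight A σ := by
  unfold ocWeight
  by_cases hv : Z.Valid A σ
  · rw [if_pos hv, if_neg (Z.not_G1_of_isEmpty_T₂ A σ), if_pos ((Z.G2_iff_valid_of_isEmpty_T₂ A σ).2 hv)]
    norm_num
  · rw [if_neg hv]

open Classical in
/-- With no `1`-edges every state has weight `[valid] ≥ 0`. -/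
theorem ocWeight_nonneg_of_isEmpty_T₁ [IsEmpty T₁] (σ : State E T₁ T₂) : 0 ≤ Z.ocWeight A σ := by
  unfold ocWeight
  by_cases hv : Z.Valid A σ
  · rw [if_pos hv, if_pos ((Z.G1_iff_valid_of_isEmpty_T₁ A σ).2 hv), if_neg (Z.not_G2_of_isEmpty_T₁ A σ)]
    norm_num
  · rw [if_neg hv]

section Sums

variable [Fintype E] [DecidableEq E] [Fintype T₁] [DecidableEq T₁] [Fintype T₂] [DecidableEq T₂] (Q : Set V)

/-- **The ZONE O-CUBE holds on zones without `2`-edges.** -/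
theorem zoneOCube_nonneg_of_isEmpty_T₂ [IsEmpty T₂] : Z.ZoneOCubeConj A Q :=
  Finset.sum_nonneg fun σ _ => Z.ocWeight_nonneg_of_isEmpty_T₂ A σ

/-- **The ZONE O-CUBE holds on zones without `1`-edges.** -/
theorem zoneOCube_nonneg_of_isEmpty_T₁ [IsEmpty T₁] : Z.ZoneOCubeConj A Q :=
  Finset.sum_nonneg fun σ _ => Z.ocWeight_nonneg_of_isEmpty_T₁ A σ

end Sums

end ZoneData

namespace FZone

open Finset

variable {V E T₁ T₂ : Type*} (F : FZone V E T₁ T₂) (A : Set V)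
variable [Fintype E] [DecidableEq E] [Fintype T₁] [DecidableEq T₁] [Fintype T₂] [DecidableEq T₂] (Q : Set V)

/-- **The ZONE O-CUBE with forced edges holds on zones without `2`-edges.** -/
theorem zoneOCubeF_nonneg_of_isEmpty_T₂ [IsEmpty T₂] : F.ZoneOCubeConjF A Q :=
  Finset.sum_nonneg fun σ _ => F.ocWeight_nonneg_of_isEmpty_T₂ A σ

/-- **The ZONE O-CUBE with forced edges holds on zones without `1`-edges.** -/
theorem zoneOCubeF_nonneg_of_isEmpty_T₁ [IsEmpty T₁] : F.ZoneOCubeConjF A Q :=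
  Finset.sum_nonneg fun σ _ => F.ocWeight_nonneg_of_isEmpty_T₁ A σ

end FZone

end ZoneZ

end PercRepro
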